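import Summits.FinalStateConjecture.FinalStateConjecture.Theorems.InertialRecession.Negative.CleanScaleCesaro
import Summits.FinalStateConjecture.FinalStateConjecture.Theorems.InertialRecession.Negative.CesaroShadow

/-!
# Negative knowledge for the crux `InertialRecession` (item stmt-FinalStateConjecture-10166), VI:
the TWO-BODY clean-scale toy is settled — Cesàro velocities with no rate and no force law

Refuter file (D-0016 negative lane, `--supports stmt-FinalStateConjecture-10166`); assembles
`CleanScaleCesaro.lean` (crossing lemma ⇒ `s(t)/t` converges when `|s''| ≤ K|s|^{-p}`, `p > 1`) and
`CesaroShadow.lean` (`tendsto_div_of_tendsto_deriv`). No Theses decl is asserted.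

`toy_two_body_cesaro`: two world-lines `ξ₁, ξ₂ : ℝ → ℝⁿ` (sup norm) with bounded speeds, whose
RELATIVE acceleration is bounded by `K ‖ξ₁ - ξ₂‖^{-p}` (`p > 1`; in crux units `p = 3/2` from the cone
weight `7/4`: the sign-less, potential-less, rate-less bound that singleton clean spheres give) and
whose TOTAL momentum `m₁ ξ₁' + m₂ ξ₂'` converges (clean spheres at scale `t`: flux `ε² t^{-3/2}`,
integrable with no rate) have CESÀRO velocities: both `ξᵢ(t)/t` converge. Nothing is assumed about
`‖ξ₁ - ξ₂‖ → ∞`, about energy, or about convergence of the individual velocities (which may fail: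
`KinematicShadow.lean`, `CesaroShadow.lean`). This is the `N = 2` case of the toy final-motion theorem
behind the crux's transfer target `CesaroVelocities` (card `cesaro-velocities-suffice`); `N ≥ 3` needs
the cluster induction (`CleanScaleEncounters.lean`, `Disproof.lean` §E).
-/

set_option linter.dupNamespace false

noncomputable section

namespace Summit.FinalStateConjecture.FinalStateConjecture.Theorems.InertialRecession.Negative

open Filter Set
open scoped Topology

/-- Coordinatewise Cesàro convergence in `ℝⁿ` (sup norm) from the scalar statements. [folklore] -/
lemma tendsto_inv_smul_of_coord {n : ℕ} {w : ℝ → (Fin n → ℝ)} {L : Fin n → ℝ}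
    (h : ∀ k, Tendsto (fun t ↦ w t k / t) atTop (𝓝 (L k))) :
    Tendsto (fun t ↦ t⁻¹ • w t) atTop (𝓝 L) := by
  rw [tendsto_pi_nhds]
  intro k
  refine (h k).congr fun t ↦ ?_
  simp [div_eq_inv_mul]

/-- **The two-body clean-scale toy.** Bounded speeds, relative acceleration `≤ K ‖ξ₁ - ξ₂‖^{-p}` with
`p > 1` wherever the bodies do not coincide, and convergent total momentum imply that both `ξᵢ(t)/t`
converge. [folklore] -/
theorem toy_two_body_cesaro {n : ℕ} {ξ₁ ξ₂ v₁ v₂ a₁ a₂ : ℝ → (Fin n → ℝ)}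
    {t₀ K p vmax m₁ m₂ : ℝ} {P : Fin n → ℝ}
    (ht₀ : 0 < t₀) (hp : 1 < p) (hK : 0 ≤ K) (hm₁ : 0 < m₁) (hm₂ : 0 < m₂)
    (h₁ : ∀ t, HasDerivAt ξ₁ (v₁ t) t) (h₁' : ∀ t, HasDerivAt v₁ (a₁ t) t)
    (h₂ : ∀ t, HasDerivAt ξ₂ (v₂ t) t) (h₂' : ∀ t, HasDerivAt v₂ (a₂ t) t)
    (hv : ∀ t, t₀ ≤ t → ‖v₁ t‖ ≤ vmax ∧ ‖v₂ t‖ ≤ vmax)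
    (hrel : ∀ t, t₀ ≤ t → ξ₁ t ≠ ξ₂ t → ‖a₁ t - a₂ t‖ ≤ K * ‖ξ₁ t - ξ₂ t‖ ^ (-p))
    (hP : Tendsto (fun t ↦ m₁ • v₁ t + m₂ • v₂ t) atTop (𝓝 P)) :
    (∃ V₁, Tendsto (fun t ↦ t⁻¹ • ξ₁ t) atTop (𝓝 V₁)) ∧
      ∃ V₂, Tendsto (fun t ↦ t⁻¹ • ξ₂ t) atTop (𝓝 V₂) := by
  -- (1) the relative coordinate `w = ξ₁ - ξ₂` has a Cesàro limit, coordinate by coordinate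
  have hw : ∀ k, ∃ Lk, Tendsto (fun t ↦ (ξ₁ t - ξ₂ t) k / t) atTop (𝓝 Lk) := by
    intro k
    refine tendsto_div_of_abs_deriv2_le_rpow (s := fun t ↦ (ξ₁ t - ξ₂ t) k)
      (s' := fun t ↦ (v₁ t - v₂ t) k) (s'' := fun t ↦ (a₁ t - a₂ t) k) (v := vmax + vmax) ht₀ hp hK
      (fun t _ ↦ hasDerivAt_pi.mp ((h₁ t).sub (h₂ t)) k)
      (fun t _ ↦ hasDerivAt_pi.mp ((h₁' t).sub (h₂' t)) k) (fun t ht ↦ ?_) (fun t ht hne ↦ ?_)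
    · have hk : |(v₁ t - v₂ t) k| ≤ ‖v₁ t - v₂ t‖ := by
        simpa using norm_le_pi_norm (v₁ t - v₂ t) k
      exact hk.trans ((norm_sub_le _ _).trans (add_le_add (hv t ht).1 (hv t ht).2))
    · have hne' : ξ₁ t ≠ ξ₂ t := by
        intro h
        apply hne
        simp [h]
      have hk : |(ξ₁ t - ξ₂ t) k| ≤ ‖ξ₁ t - ξ₂ t‖ := by
        simpa using norm_le_pi_norm (ξ₁ t - ξ₂ t) k
      have hk'' : |(a₁ t - a₂ t) k| ≤ ‖a₁ t - a₂ t‖ := by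
        simpa using norm_le_pi_norm (a₁ t - a₂ t) k
      have hpos : 0 < |(ξ₁ t - ξ₂ t) k| := abs_pos.mpr hne
      calc |(a₁ t - a₂ t) k| ≤ ‖a₁ t - a₂ t‖ := hk''
        _ ≤ K * ‖ξ₁ t - ξ₂ t‖ ^ (-p) := hrel t ht hne'
        _ ≤ K * |(ξ₁ t - ξ₂ t) k| ^ (-p) :=
            mul_le_mul_of_nonneg_left (Real.rpow_le_rpow_of_nonpos hpos hk (by linarith)) hK
  choose L hL using hw
  have hwlim : Tendsto (fun t ↦ t⁻¹ • (ξ₁ t - ξ₂ t)) atTop (𝓝 L) := tendsto_inv_smul_of_coord hL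
  -- (2) the total momentum coordinate `X = m₁ ξ₁ + m₂ ξ₂` has a Cesàro limit (frozen ⇒ Cesàro)
  have hX : Tendsto (fun t ↦ t⁻¹ • (m₁ • ξ₁ t + m₂ • ξ₂ t)) atTop (𝓝 P) := by
    refine tendsto_inv_smul_of_coord fun k ↦ ?_
    have hd : ∀ t, HasDerivAt (fun t ↦ (m₁ • ξ₁ t + m₂ • ξ₂ t) k) ((m₁ • v₁ t + m₂ • v₂ t) k) t :=
      fun t ↦ hasDerivAt_pi.mp (((h₁ t).const_smul m₁).add ((h₂ t).const_smul m₂)) k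
    exact tendsto_div_of_tendsto_deriv hd ((continuous_apply k).tendsto P |>.comp hP)
  -- (3) recombine: `ξ₁ = (X + m₂ w)/(m₁ + m₂)`, `ξ₂ = (X - m₁ w)/(m₁ + m₂)`
  have hM : m₁ + m₂ ≠ 0 := by positivity
  refine ⟨⟨(m₁ + m₂)⁻¹ • (P + m₂ • L), ?_⟩, ⟨(m₁ + m₂)⁻¹ • (P - m₁ • L), ?_⟩⟩
  · have := (hX.add (hwlim.const_smul m₂)).const_smul (m₁ + m₂)⁻¹
    refine this.congr fun t ↦ ?_
    ext k
    simp only [Pi.smul_apply, Pi.add_apply, Pi.sub_apply, smul_eq_mul]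
    field_simp
    ring
  · have := (hX.sub (hwlim.const_smul m₁)).const_smul (m₁ + m₂)⁻¹
    refine this.congr fun t ↦ ?_
    ext k
    simp only [Pi.smul_apply, Pi.add_apply, Pi.sub_apply, smul_eq_mul]
    field_simp
    ring

end Summit.FinalStateConjecture.FinalStateConjecture.Theorems.InertialRecession.Negative

end
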